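import Literature.Geometry.Symplectic.SphereCROperatorGlobal
import Literature.Geometry.Symplectic.SphereACDataOfProductNbhd
import Literature.Geometry.Symplectic.JSphereFamilyLeafFunction
import HarnessLib

/-!
# Gluing the two chart maps of a family of spheres in a product neighbourhood

Layer B6 (manifold packaging) of the analytic core of the Hofer–Lizan–Sikorav local foliation
theorem (C. Wendl, *Holomorphic Curves in Low Dimensions* (2018), Thm. 2.46 / Prop. 2.53; lead of
crux `WitnessCharge`, summit `SmoothPoincare4`). Setting: `ι : ℂℙ¹ × ℂ → X` (a product
neighbourhood of an embedded sphere with trivial normal bundle), its two product charts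
`prodChart i ι` (`ProjectiveLineProductCharts.lean`), chart data `𝒥 : SphereACData`, and a
family, indexed by `a` with `|a| < ε`, of sections `(Ξ₀ a, Ξ₁ a)` of `T ℂℙ¹`
(`Ξ₁ a w = -w² Ξ₀ a w⁻¹`) and functions `(Φ₀ a, Φ₁ a)` (`Φ₁ a w = Φ₀ a w⁻¹`), jointly `C^∞` on
`B_ε × ℂ`, with `‖Ξᵢ a‖ < 2⁻¹` on the discs of radius `2`. The chart maps are
`𝒥.vmap₀ (Ξ₀ a) (Φ₀ a) z = (expChart z (Ξ₀ a z), Qinv₀ z (Φ₀ a z))` and `𝒥.vmap₁ (Ξ₁ a) (Φ₁ a)`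
(`SphereCROperatorPointwise.lean`). The **glued two-chart family** is
`U a z = prodChart 0 ι (vmap₀ … z)` for `|z| < 2`, `= prodChart 1 ι (vmap₁ … z⁻¹)` for `|z| ≥ 2`,
and `V a w = U a w⁻¹` (`V a 0 = prodChart 1 ι (vmap₁ … 0)`); these defining equations are taken
as hypotheses `hU`, `hV` (no new definitions).

Results (namespace `Literature.Geometry.Symplectic.SphereCR`):
* `prodChart_one_vmap₁_inv` — **the key agreement on the overlap**:
  `prodChart 1 ι (vmap₁ (Ξ₁ a) (Φ₁ a) z⁻¹) = prodChart 0 ι (vmap₀ (Ξ₀ a) (Φ₀ a) z)` whenever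
  `z ≠ 0` and `expChart z (Ξ₀ a z) ≠ 0` (clutching, the equivariance `inv_expChart` of the
  exponential chart, `Qinv₁ w = Qinv₀ w⁻¹`, and `prodChart 1 ι = prodChart 0 ι ∘ psi`);
  `expChart_ne_zero_of_half_le_norm` supplies the nonvanishing for `2⁻¹ ≤ |z|`, `‖Ξ₀ a z‖ < 2⁻¹`;
* the local chart forms of the glued family: `glueU_eq_chart₀` (`|z| < 2`), `glueU_eq_chart₁`
  (`|z| > 2⁻¹`), `glueV_eq_chart₁` (`|w| < 2`), `glueV_eq_chart₀` (`|w| > 2⁻¹`), and their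
  `∀ᶠ` forms jointly in `(a, z)`;
* the central leaf: `glueU_zero` (`U 0 = u₀`), `glueV_zero` (`V 0 = v₀`) when the data vanish at
  `a = 0` and `ι (θ, 0)` is the glued map of `(u₀, v₀)`;
* calculus of the chart maps of the family: `differentiableAt_vmap₀_family`,
  `differentiableAt_vmap₁_family` (on the closed discs of radius `2`), `contDiffOn_vmap₀_family`,
  `contDiffOn_vmap₁_family` (jointly `C^∞` on `B_ε × B_2`).

The `J`-holomorphicity, joint smoothness and effectiveness of the glued family are in
`SphereFamilyTwoChartLeaves.lean`.

## References

* C. Wendl, *Holomorphic Curves in Low Dimensions*, LNM 2216 (2018), §2.3, Thm. 2.46, Prop. 2.53.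
  [Wendl2018]
* D. McDuff, D. Salamon, *J-holomorphic Curves and Symplectic Topology*, 2nd ed. (2012), §2.2,
  §3.1. [McDuffSalamon2012]
-/

noncomputable section

open scoped Manifold ContDiff Topology
open Set Function Filter
open Literature.Topology.FourManifolds Literature.Topology.FourManifolds.ComplexProjectiveSpace
  Literature.Analysis.Complex.ProjectiveLineExpChart

namespace Literature.Geometry.Symplectic

namespace SphereCR

/-! ### Elementary estimates -/

/-- For `2⁻¹ ≤ ‖z‖` and `‖c‖ < 2⁻¹`, `expChart z c ≠ 0`: its numerator `z (1 + |z|²) + c` has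
`‖z (1 + |z|²)‖ ≥ 5/8 > ‖c‖`. [folklore] -/
theorem expChart_ne_zero_of_half_le_norm {z c : ℂ} (hz : 2⁻¹ ≤ ‖z‖) (hc : ‖c‖ < 2⁻¹) :
    expChart z c ≠ 0 := fun h => by
  have h1 : z * (1 + (Complex.normSq z : ℂ)) = -c := eq_neg_of_add_eq_zero_left
    ((expChart_eq_zero_iff (den_ne_zero_of_norm_lt_two (hc.trans (by norm_num)))).1 h)
  have h2 : ‖z * (1 + (Complex.normSq z : ℂ))‖ = ‖z‖ * (1 + ‖z‖ ^ 2) := by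
    rw [norm_mul, norm_one_add_normSq]
  have h3 : ‖z‖ * (1 + ‖z‖ ^ 2) = ‖c‖ := by rw [← h2, h1, norm_neg]
  nlinarith [sq_nonneg ‖z‖, norm_nonneg z]

/-- At the origin the exponential chart is the identity of the fibre: `expChart 0 c = c`.
[folklore] -/
theorem expChart_zero_left (c : ℂ) : expChart 0 c = c := by
  simp [expChart, den]

/-- `2⁻¹ < ‖z‖` gives `z ≠ 0` and `‖z⁻¹‖ < 2`. [folklore] -/
theorem ne_zero_and_norm_inv_lt_two {z : ℂ} (hz : 2⁻¹ < ‖z‖) : z ≠ 0 ∧ ‖z⁻¹‖ < 2 := by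
  have hz0 : z ≠ 0 := fun h => by rw [h, norm_zero] at hz; norm_num at hz
  refine ⟨hz0, ?_⟩
  rw [norm_inv]
  have h := inv_strictAnti₀ (by norm_num : (0 : ℝ) < 2⁻¹) hz
  rwa [inv_inv] at h

/-- `‖z‖ < 2` and `z ≠ 0` give `2⁻¹ < ‖z⁻¹‖`. [folklore] -/
theorem half_lt_norm_inv {z : ℂ} (hz : ‖z‖ < 2) (hz0 : z ≠ 0) : 2⁻¹ < ‖z⁻¹‖ := by
  rw [norm_inv]
  exact inv_strictAnti₀ (norm_pos_iff.2 hz0) hz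

/-- `¬ ‖z‖ < 2` gives `z ≠ 0`, `2⁻¹ < ‖z‖` and `‖z⁻¹‖ < 2`. [folklore] -/
theorem overlap_of_not_norm_lt_two {z : ℂ} (hz : ¬‖z‖ < 2) : z ≠ 0 ∧ 2⁻¹ < ‖z‖ ∧ ‖z⁻¹‖ < 2 := by
  have h2 : 2⁻¹ < ‖z‖ := lt_of_lt_of_le (by norm_num) (not_lt.1 hz)
  exact ⟨(ne_zero_and_norm_inv_lt_two h2).1, h2, (ne_zero_and_norm_inv_lt_two h2).2⟩

/-- Membership in `B_ε × B_2`. [folklore] -/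
theorem mem_ball_prod_ball {ε : ℝ} {q : ℂ × ℂ} (ha : ‖q.1‖ < ε) (hz : ‖q.2‖ < 2) :
    q ∈ Metric.ball (0 : ℂ) ε ×ˢ Metric.ball (0 : ℂ) 2 :=
  ⟨mem_ball_zero_iff.2 ha, mem_ball_zero_iff.2 hz⟩

/-- `B_ε × B_2` is open. [folklore] -/
theorem isOpen_ball_prod_ball (ε : ℝ) : IsOpen (Metric.ball (0 : ℂ) ε ×ˢ Metric.ball (0 : ℂ) 2) :=
  Metric.isOpen_ball.prod Metric.isOpen_ball

/-! ### The glued family: agreement of the two chart expressions on the overlap -/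

section Family

variable {X : Type*} {ι : ComplexProjectiveSpace 1 × ℂ → X} {𝒥 : SphereACData} {ε : ℝ}
  {Ξ₀ Ξ₁ Φ₀ Φ₁ : ℂ → ℂ → ℂ} {U V : ℂ → ℂ → X}

/-- **KEY AGREEMENT of the two chart expressions on the overlap**: for `|a| < ε`, `z ≠ 0` and
`expChart z (Ξ₀ a z) ≠ 0`,
`prodChart 1 ι (vmap₁ (Ξ₁ a) (Φ₁ a) z⁻¹) = prodChart 0 ι (vmap₀ (Ξ₀ a) (Φ₀ a) z)`:
by the clutching relations, the equivariance `(expChart z c)⁻¹ = expChart z⁻¹ (-(z⁻¹)² c)` and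
`Qinv₁ w = Qinv₀ w⁻¹` one has `vmap₁ … z⁻¹ = psi (vmap₀ … z)`, and
`prodChart 1 ι = prodChart 0 ι ∘ psi`. [cite: Wendl2018, §2.3] -/
theorem prodChart_one_vmap₁_inv
    (hclutch : ∀ a : ℂ, ‖a‖ < ε → ∀ w : ℂ, w ≠ 0 →
      Ξ₁ a w = -w ^ 2 * Ξ₀ a w⁻¹ ∧ Φ₁ a w = Φ₀ a w⁻¹)
    {a : ℂ} (ha : ‖a‖ < ε) {z : ℂ} (hz : z ≠ 0) (hne : expChart z (Ξ₀ a z) ≠ 0) :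
    prodChart 1 ι (𝒥.vmap₁ (Ξ₁ a) (Φ₁ a) z⁻¹) = prodChart 0 ι (𝒥.vmap₀ (Ξ₀ a) (Φ₀ a) z) := by
  have h1 : 𝒥.vmap₁ (Ξ₁ a) (Φ₁ a) z⁻¹ = psi (𝒥.vmap₀ (Ξ₀ a) (Φ₀ a) z) := by
    obtain ⟨hΞ, hΦ⟩ := hclutch a ha z⁻¹ (inv_ne_zero hz)
    rw [inv_inv] at hΞ hΦ
    show (expChart z⁻¹ (Ξ₁ a z⁻¹), 𝒥.Qinv₁ z⁻¹ (Φ₁ a z⁻¹)) =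
      ((expChart z (Ξ₀ a z))⁻¹, 𝒥.Qinv₀ z (Φ₀ a z))
    rw [hΞ, hΦ, 𝒥.Qinv₁_eq z⁻¹ (inv_ne_zero hz), inv_inv, inv_expChart hz]
  have hy : (psi (𝒥.vmap₀ (Ξ₀ a) (Φ₀ a) z)).1 ≠ 0 := inv_ne_zero hne
  rw [h1, prodChart_one_eq_prodChart_zero_psi ι hy, psi_psi]

/-- The chart-`0` form of the glued `U` on the disc `|z| < 2` (by definition). [folklore] -/
theorem glueU_eq_chart₀
    (hU : ∀ a z, U a z = if ‖z‖ < 2 then prodChart 0 ι (𝒥.vmap₀ (Ξ₀ a) (Φ₀ a) z)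
      else prodChart 1 ι (𝒥.vmap₁ (Ξ₁ a) (Φ₁ a) z⁻¹))
    (a : ℂ) {z : ℂ} (hz : ‖z‖ < 2) : U a z = prodChart 0 ι (𝒥.vmap₀ (Ξ₀ a) (Φ₀ a) z) := by
  rw [hU, if_pos hz]

/-- **The chart-`1` form of the glued `U` off the disc `|z| ≤ 2⁻¹`**: for `|a| < ε` and
`2⁻¹ < |z|`, `U a z = prodChart 1 ι (vmap₁ (Ξ₁ a) (Φ₁ a) z⁻¹)` (by definition for `|z| ≥ 2`, by
the key agreement for `2⁻¹ < |z| < 2`, where `‖Ξ₀ a z‖ < 2⁻¹`). [cite: Wendl2018, §2.3] -/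
theorem glueU_eq_chart₁
    (hclutch : ∀ a : ℂ, ‖a‖ < ε → ∀ w : ℂ, w ≠ 0 →
      Ξ₁ a w = -w ^ 2 * Ξ₀ a w⁻¹ ∧ Φ₁ a w = Φ₀ a w⁻¹)
    (hΞ₀b : ∀ a : ℂ, ‖a‖ < ε → ∀ z : ℂ, ‖z‖ ≤ 2 → ‖Ξ₀ a z‖ < 2⁻¹)
    (hU : ∀ a z, U a z = if ‖z‖ < 2 then prodChart 0 ι (𝒥.vmap₀ (Ξ₀ a) (Φ₀ a) z)
      else prodChart 1 ι (𝒥.vmap₁ (Ξ₁ a) (Φ₁ a) z⁻¹))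
    {a : ℂ} (ha : ‖a‖ < ε) {z : ℂ} (hz : 2⁻¹ < ‖z‖) :
    U a z = prodChart 1 ι (𝒥.vmap₁ (Ξ₁ a) (Φ₁ a) z⁻¹) := by
  rw [hU]
  split_ifs with h2
  · exact (prodChart_one_vmap₁_inv hclutch ha (ne_zero_and_norm_inv_lt_two hz).1
      (expChart_ne_zero_of_half_le_norm hz.le (hΞ₀b a ha z h2.le))).symm
  · rfl

/-- **The chart-`1` form of the glued `V` on the disc `|w| < 2`**: `V a w = prodChart 1 ι (vmap₁
(Ξ₁ a) (Φ₁ a) w)` for `|a| < ε` (`V a w = U a w⁻¹` and `glueU_eq_chart₁`).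
[cite: Wendl2018, §2.3] -/
theorem glueV_eq_chart₁
    (hclutch : ∀ a : ℂ, ‖a‖ < ε → ∀ w : ℂ, w ≠ 0 →
      Ξ₁ a w = -w ^ 2 * Ξ₀ a w⁻¹ ∧ Φ₁ a w = Φ₀ a w⁻¹)
    (hΞ₀b : ∀ a : ℂ, ‖a‖ < ε → ∀ z : ℂ, ‖z‖ ≤ 2 → ‖Ξ₀ a z‖ < 2⁻¹)
    (hU : ∀ a z, U a z = if ‖z‖ < 2 then prodChart 0 ι (𝒥.vmap₀ (Ξ₀ a) (Φ₀ a) z)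
      else prodChart 1 ι (𝒥.vmap₁ (Ξ₁ a) (Φ₁ a) z⁻¹))
    (hV : ∀ a w, V a w = if w = 0 then prodChart 1 ι (𝒥.vmap₁ (Ξ₁ a) (Φ₁ a) 0) else U a w⁻¹)
    {a : ℂ} (ha : ‖a‖ < ε) {w : ℂ} (hw : ‖w‖ < 2) :
    V a w = prodChart 1 ι (𝒥.vmap₁ (Ξ₁ a) (Φ₁ a) w) := by
  rw [hV]
  split_ifs with h0
  · rw [h0]
  · rw [glueU_eq_chart₁ hclutch hΞ₀b hU ha (half_lt_norm_inv hw h0), inv_inv]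

/-- **The chart-`0` form of the glued `V` off the disc `|w| ≤ 2⁻¹`**:
`V a w = prodChart 0 ι (vmap₀ (Ξ₀ a) (Φ₀ a) w⁻¹)` (by the definitions). [folklore] -/
theorem glueV_eq_chart₀
    (hU : ∀ a z, U a z = if ‖z‖ < 2 then prodChart 0 ι (𝒥.vmap₀ (Ξ₀ a) (Φ₀ a) z)
      else prodChart 1 ι (𝒥.vmap₁ (Ξ₁ a) (Φ₁ a) z⁻¹))
    (hV : ∀ a w, V a w = if w = 0 then prodChart 1 ι (𝒥.vmap₁ (Ξ₁ a) (Φ₁ a) 0) else U a w⁻¹)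
    (a : ℂ) {w : ℂ} (hw : 2⁻¹ < ‖w‖) :
    V a w = prodChart 0 ι (𝒥.vmap₀ (Ξ₀ a) (Φ₀ a) w⁻¹) := by
  obtain ⟨hw0, hw2⟩ := ne_zero_and_norm_inv_lt_two hw
  rw [hV, if_neg hw0, hU, if_pos hw2]

/-- Jointly in `(a, z)`: the glued `U` near a point with `|z| < 2` is the chart-`0` model.
[folklore] -/
theorem glueU_eventuallyEq_chart₀
    (hU : ∀ a z, U a z = if ‖z‖ < 2 then prodChart 0 ι (𝒥.vmap₀ (Ξ₀ a) (Φ₀ a) z)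
      else prodChart 1 ι (𝒥.vmap₁ (Ξ₁ a) (Φ₁ a) z⁻¹))
    {q : ℂ × ℂ} (hq : ‖q.2‖ < 2) :
    (fun q : ℂ × ℂ => U q.1 q.2) =ᶠ[𝓝 q]
      fun q : ℂ × ℂ => prodChart 0 ι (𝒥.vmap₀ (Ξ₀ q.1) (Φ₀ q.1) q.2) := by
  filter_upwards [((isOpen_lt continuous_norm continuous_const).preimage continuous_snd).mem_nhds
    (show q ∈ Prod.snd ⁻¹' {z : ℂ | ‖z‖ < 2} from hq)] with q' hq'
  exact glueU_eq_chart₀ hU q'.1 hq'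

/-- Jointly in `(a, z)`: the glued `U` near a point with `|a| < ε`, `2⁻¹ < |z|` is the chart-`1`
model precomposed with `(a, z) ↦ (a, z⁻¹)`. [folklore] -/
theorem glueU_eventuallyEq_chart₁
    (hclutch : ∀ a : ℂ, ‖a‖ < ε → ∀ w : ℂ, w ≠ 0 →
      Ξ₁ a w = -w ^ 2 * Ξ₀ a w⁻¹ ∧ Φ₁ a w = Φ₀ a w⁻¹)
    (hΞ₀b : ∀ a : ℂ, ‖a‖ < ε → ∀ z : ℂ, ‖z‖ ≤ 2 → ‖Ξ₀ a z‖ < 2⁻¹)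
    (hU : ∀ a z, U a z = if ‖z‖ < 2 then prodChart 0 ι (𝒥.vmap₀ (Ξ₀ a) (Φ₀ a) z)
      else prodChart 1 ι (𝒥.vmap₁ (Ξ₁ a) (Φ₁ a) z⁻¹))
    {q : ℂ × ℂ} (ha : ‖q.1‖ < ε) (hq : 2⁻¹ < ‖q.2‖) :
    (fun q : ℂ × ℂ => U q.1 q.2) =ᶠ[𝓝 q]
      (fun q : ℂ × ℂ => prodChart 1 ι (𝒥.vmap₁ (Ξ₁ q.1) (Φ₁ q.1) q.2)) ∘
        fun q : ℂ × ℂ => (q.1, q.2⁻¹) := by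
  have hO : IsOpen (Metric.ball (0 : ℂ) ε ×ˢ {z : ℂ | 2⁻¹ < ‖z‖}) :=
    Metric.isOpen_ball.prod (isOpen_lt continuous_const continuous_norm)
  filter_upwards [hO.mem_nhds ⟨mem_ball_zero_iff.2 ha, hq⟩] with q' hq'
  exact glueU_eq_chart₁ hclutch hΞ₀b hU (mem_ball_zero_iff.1 hq'.1) hq'.2

/-- Jointly in `(a, w)`: the glued `V` near a point with `|a| < ε`, `|w| < 2` is the chart-`1`
model. [folklore] -/
theorem glueV_eventuallyEq_chart₁
    (hclutch : ∀ a : ℂ, ‖a‖ < ε → ∀ w : ℂ, w ≠ 0 →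
      Ξ₁ a w = -w ^ 2 * Ξ₀ a w⁻¹ ∧ Φ₁ a w = Φ₀ a w⁻¹)
    (hΞ₀b : ∀ a : ℂ, ‖a‖ < ε → ∀ z : ℂ, ‖z‖ ≤ 2 → ‖Ξ₀ a z‖ < 2⁻¹)
    (hU : ∀ a z, U a z = if ‖z‖ < 2 then prodChart 0 ι (𝒥.vmap₀ (Ξ₀ a) (Φ₀ a) z)
      else prodChart 1 ι (𝒥.vmap₁ (Ξ₁ a) (Φ₁ a) z⁻¹))
    (hV : ∀ a w, V a w = if w = 0 then prodChart 1 ι (𝒥.vmap₁ (Ξ₁ a) (Φ₁ a) 0) else U a w⁻¹)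
    {q : ℂ × ℂ} (ha : ‖q.1‖ < ε) (hq : ‖q.2‖ < 2) :
    (fun q : ℂ × ℂ => V q.1 q.2) =ᶠ[𝓝 q]
      fun q : ℂ × ℂ => prodChart 1 ι (𝒥.vmap₁ (Ξ₁ q.1) (Φ₁ q.1) q.2) := by
  filter_upwards [(isOpen_ball_prod_ball ε).mem_nhds (mem_ball_prod_ball ha hq)] with q' hq'
  exact glueV_eq_chart₁ hclutch hΞ₀b hU hV (mem_ball_zero_iff.1 hq'.1) (mem_ball_zero_iff.1 hq'.2)

/-- Jointly in `(a, w)`: the glued `V` near a point with `2⁻¹ < |w|` is the chart-`0` model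
precomposed with `(a, w) ↦ (a, w⁻¹)`. [folklore] -/
theorem glueV_eventuallyEq_chart₀
    (hU : ∀ a z, U a z = if ‖z‖ < 2 then prodChart 0 ι (𝒥.vmap₀ (Ξ₀ a) (Φ₀ a) z)
      else prodChart 1 ι (𝒥.vmap₁ (Ξ₁ a) (Φ₁ a) z⁻¹))
    (hV : ∀ a w, V a w = if w = 0 then prodChart 1 ι (𝒥.vmap₁ (Ξ₁ a) (Φ₁ a) 0) else U a w⁻¹)
    {q : ℂ × ℂ} (hq : 2⁻¹ < ‖q.2‖) :
    (fun q : ℂ × ℂ => V q.1 q.2) =ᶠ[𝓝 q]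
      (fun q : ℂ × ℂ => prodChart 0 ι (𝒥.vmap₀ (Ξ₀ q.1) (Φ₀ q.1) q.2)) ∘
        fun q : ℂ × ℂ => (q.1, q.2⁻¹) := by
  filter_upwards [((isOpen_lt continuous_const continuous_norm).preimage continuous_snd).mem_nhds
    (show q ∈ Prod.snd ⁻¹' {z : ℂ | 2⁻¹ < ‖z‖} from hq)] with q' hq'
  exact glueV_eq_chart₀ hU hV q'.1 hq'

/-- **The central leaf of the glued `U` is `u₀`**: at `a = 0` the data vanish,
`vmap₀ 0 0 z = (z, 0)`, `vmap₁ 0 0 w = (w, 0)`, and `prodChart 0 ι (z, 0) = u₀ z`,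
`prodChart 1 ι (z⁻¹, 0) = v₀ z⁻¹ = u₀ z`. [folklore] -/
theorem glueU_zero [TopologicalSpace X] {u₀ v₀ : ℂ → X} {F₀ : C(ComplexProjectiveSpace 1, X)}
    (hF₀u : ∀ p, CoordNeZero 0 p → F₀ p = u₀ (affineCoordComplex 0 p 0))
    (hF₀v : ∀ p, CoordNeZero 1 p → F₀ p = v₀ (affineCoordComplex 1 p 0))
    (hιF : ∀ θ, ι (θ, 0) = F₀ θ) (hc : ∀ z : ℂ, z ≠ 0 → v₀ z = u₀ z⁻¹)
    (hzero : ∀ z : ℂ, Ξ₀ 0 z = 0 ∧ Φ₀ 0 z = 0 ∧ Ξ₁ 0 z = 0 ∧ Φ₁ 0 z = 0)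
    (hU : ∀ a z, U a z = if ‖z‖ < 2 then prodChart 0 ι (𝒥.vmap₀ (Ξ₀ a) (Φ₀ a) z)
      else prodChart 1 ι (𝒥.vmap₁ (Ξ₁ a) (Φ₁ a) z⁻¹)) (z : ℂ) :
    U 0 z = u₀ z := by
  rw [hU]
  split_ifs with h2
  · have hv : 𝒥.vmap₀ (Ξ₀ 0) (Φ₀ 0) z = (z, 0) := by
      show (expChart z (Ξ₀ 0 z), 𝒥.Qinv₀ z (Φ₀ 0 z)) = (z, 0)
      rw [(hzero z).1, (hzero z).2.1, expChart_zero, map_zero]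
    rw [hv, prodChart_zero_axis hF₀u hιF]
  · have hz0 : z ≠ 0 := (overlap_of_not_norm_lt_two h2).1
    have hv : 𝒥.vmap₁ (Ξ₁ 0) (Φ₁ 0) z⁻¹ = (z⁻¹, 0) := by
      show (expChart z⁻¹ (Ξ₁ 0 z⁻¹), 𝒥.Qinv₁ z⁻¹ (Φ₁ 0 z⁻¹)) = (z⁻¹, 0)
      rw [(hzero z⁻¹).2.2.1, (hzero z⁻¹).2.2.2, expChart_zero, map_zero]
    rw [hv, prodChart_one_axis hF₀v hιF, hc z⁻¹ (inv_ne_zero hz0), inv_inv]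

/-- **The central leaf of the glued `V` is `v₀`.** [folklore] -/
theorem glueV_zero [TopologicalSpace X] {u₀ v₀ : ℂ → X} {F₀ : C(ComplexProjectiveSpace 1, X)}
    (hF₀v : ∀ p, CoordNeZero 1 p → F₀ p = v₀ (affineCoordComplex 1 p 0))
    (hιF : ∀ θ, ι (θ, 0) = F₀ θ) (hc : ∀ z : ℂ, z ≠ 0 → v₀ z = u₀ z⁻¹)
    (hzero : ∀ z : ℂ, Ξ₀ 0 z = 0 ∧ Φ₀ 0 z = 0 ∧ Ξ₁ 0 z = 0 ∧ Φ₁ 0 z = 0)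
    (hV : ∀ a w, V a w = if w = 0 then prodChart 1 ι (𝒥.vmap₁ (Ξ₁ a) (Φ₁ a) 0) else U a w⁻¹)
    (hU0 : ∀ z, U 0 z = u₀ z) (w : ℂ) : V 0 w = v₀ w := by
  rw [hV]
  split_ifs with h0
  · have hv : 𝒥.vmap₁ (Ξ₁ 0) (Φ₁ 0) 0 = (0, 0) := by
      show (expChart 0 (Ξ₁ 0 0), 𝒥.Qinv₁ 0 (Φ₁ 0 0)) = (0, 0)
      rw [(hzero 0).2.2.1, (hzero 0).2.2.2, expChart_zero, map_zero]
    rw [h0, hv, prodChart_one_axis hF₀v hιF]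
  · rw [hU0, hc w h0]

end Family

/-! ### Calculus of the chart maps of the family -/

section Models

variable {𝒥 : SphereACData} {ε : ℝ}

/-- A slice `z ↦ F a z` (`|a| < ε`) of a function jointly `C^∞` on `B_ε × ℂ` is `C^∞`. [folklore] -/
theorem contDiffAt_slice {F : ℂ → ℂ → ℂ}
    (hF : ContDiffOn ℝ ∞ (fun q : ℂ × ℂ => F q.1 q.2) (Metric.ball 0 ε ×ˢ Set.univ))
    {a : ℂ} (ha : ‖a‖ < ε) (z : ℂ) : ContDiffAt ℝ ∞ (F a) z := by
  have h1 : ContDiffAt ℝ ∞ (fun q : ℂ × ℂ => F q.1 q.2) (a, z) :=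
    hF.contDiffAt ((isOpen_paramDomain ε).mem_nhds (mem_paramDomain ha))
  exact h1.comp z (contDiffAt_const.prodMk contDiffAt_id)

/-- The slice `a ↦ F a 0` of a function jointly `C^∞` on `B_ε × ℂ` is `C^∞` at `a = 0`
(`0 < ε`). [folklore] -/
theorem contDiffAt_slice_zero_left {F : ℂ → ℂ → ℂ}
    (hF : ContDiffOn ℝ ∞ (fun q : ℂ × ℂ => F q.1 q.2) (Metric.ball 0 ε ×ˢ Set.univ))
    (hε : 0 < ε) : ContDiffAt ℝ ∞ (fun a : ℂ => F a 0) 0 := by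
  have h0 : ‖(0 : ℂ)‖ < ε := by rwa [norm_zero]
  have h1 : ContDiffAt ℝ ∞ (fun q : ℂ × ℂ => F q.1 q.2) (0, 0) :=
    hF.contDiffAt ((isOpen_paramDomain ε).mem_nhds (mem_paramDomain h0))
  have h2 : ContDiffAt ℝ ∞ (fun a : ℂ => ((a, 0) : ℂ × ℂ)) 0 :=
    contDiffAt_id.prodMk contDiffAt_const
  exact ContDiffAt.comp (g := fun q : ℂ × ℂ => F q.1 q.2) (f := fun a : ℂ => ((a, 0) : ℂ × ℂ))
    0 h1 h2

/-- The chart-`0` map `vmap₀ (Ξ₀ a) (Φ₀ a)` of the family is real-differentiable at a point of the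
disc `|z| ≤ 2` (`expChart` is differentiable where `den ≠ 0`, `Qinv₀` is `C^∞`). [folklore] -/
theorem differentiableAt_vmap₀_family {Ξ₀ Φ₀ : ℂ → ℂ → ℂ}
    (hΞ₀s : ContDiffOn ℝ ∞ (fun q : ℂ × ℂ => Ξ₀ q.1 q.2) (Metric.ball 0 ε ×ˢ Set.univ))
    (hΦ₀s : ContDiffOn ℝ ∞ (fun q : ℂ × ℂ => Φ₀ q.1 q.2) (Metric.ball 0 ε ×ˢ Set.univ))
    (hΞ₀b : ∀ a : ℂ, ‖a‖ < ε → ∀ z : ℂ, ‖z‖ ≤ 2 → ‖Ξ₀ a z‖ < 2⁻¹)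
    {a : ℂ} (ha : ‖a‖ < ε) {z : ℂ} (hz : ‖z‖ ≤ 2) :
    DifferentiableAt ℝ (𝒥.vmap₀ (Ξ₀ a) (Φ₀ a)) z := by
  refine DifferentiableAt.prodMk ?_ ?_
  · exact (hasFDerivAt_expChart_comp
      ((contDiffAt_slice hΞ₀s ha z).differentiableAt (by simp)).hasFDerivAt
      (den_ne_zero_of_norm_lt_two ((hΞ₀b a ha z hz).trans (by norm_num)))).differentiableAt
  · exact ((𝒥.contDiff_Qinv₀_and.1.differentiable (by simp)).differentiableAt).clm_apply
      ((contDiffAt_slice hΦ₀s ha z).differentiableAt (by simp))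

/-- The chart-`1` map `vmap₁ (Ξ₁ a) (Φ₁ a)` of the family is real-differentiable at a point of the
disc `|w| ≤ 2`. [folklore] -/
theorem differentiableAt_vmap₁_family {Ξ₁ Φ₁ : ℂ → ℂ → ℂ}
    (hΞ₁s : ContDiffOn ℝ ∞ (fun q : ℂ × ℂ => Ξ₁ q.1 q.2) (Metric.ball 0 ε ×ˢ Set.univ))
    (hΦ₁s : ContDiffOn ℝ ∞ (fun q : ℂ × ℂ => Φ₁ q.1 q.2) (Metric.ball 0 ε ×ˢ Set.univ))
    (hΞ₁b : ∀ a : ℂ, ‖a‖ < ε → ∀ w : ℂ, ‖w‖ ≤ 2 → ‖Ξ₁ a w‖ < 2⁻¹)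
    {a : ℂ} (ha : ‖a‖ < ε) {w : ℂ} (hw : ‖w‖ ≤ 2) :
    DifferentiableAt ℝ (𝒥.vmap₁ (Ξ₁ a) (Φ₁ a)) w := by
  refine DifferentiableAt.prodMk ?_ ?_
  · exact (hasFDerivAt_expChart_comp
      ((contDiffAt_slice hΞ₁s ha w).differentiableAt (by simp)).hasFDerivAt
      (den_ne_zero_of_norm_lt_two ((hΞ₁b a ha w hw).trans (by norm_num)))).differentiableAt
  · exact ((𝒥.contDiff_Qinv₁_and.1.differentiable (by simp)).differentiableAt).clm_apply
      ((contDiffAt_slice hΦ₁s ha w).differentiableAt (by simp))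

/-- **Joint smoothness of the chart-`0` map of the family** on `B_ε × B_2`:
`(a, z) ↦ vmap₀ (Ξ₀ a) (Φ₀ a) z = (expChart z (Ξ₀ a z), Qinv₀ z (Φ₀ a z))` is `C^∞` there
(`expChart` is `C^∞` on `{den ≠ 0}`, `Qinv₀` is `C^∞`). [folklore] -/
theorem contDiffOn_vmap₀_family {Ξ₀ Φ₀ : ℂ → ℂ → ℂ}
    (hΞ₀s : ContDiffOn ℝ ∞ (fun q : ℂ × ℂ => Ξ₀ q.1 q.2) (Metric.ball 0 ε ×ˢ Set.univ))
    (hΦ₀s : ContDiffOn ℝ ∞ (fun q : ℂ × ℂ => Φ₀ q.1 q.2) (Metric.ball 0 ε ×ˢ Set.univ))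
    (hΞ₀b : ∀ a : ℂ, ‖a‖ < ε → ∀ z : ℂ, ‖z‖ ≤ 2 → ‖Ξ₀ a z‖ < 2⁻¹) :
    ContDiffOn ℝ ∞ (fun q : ℂ × ℂ => 𝒥.vmap₀ (Ξ₀ q.1) (Φ₀ q.1) q.2)
      (Metric.ball 0 ε ×ˢ Metric.ball 0 2) := by
  have hsub : Metric.ball (0 : ℂ) ε ×ˢ Metric.ball (0 : ℂ) 2 ⊆ Metric.ball 0 ε ×ˢ Set.univ :=
    prod_mono Subset.rfl (subset_univ _)
  have h1 : ContDiffOn ℝ ∞ (fun q : ℂ × ℂ => expChart q.2 (Ξ₀ q.1 q.2))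
      (Metric.ball 0 ε ×ˢ Metric.ball 0 2) := by
    refine contDiffOn_expChart.comp (contDiffOn_snd.prodMk (hΞ₀s.mono hsub)) ?_
    intro q hq
    show den q.2 (Ξ₀ q.1 q.2) ≠ 0
    exact den_ne_zero_of_norm_lt_two
      ((hΞ₀b q.1 (mem_ball_zero_iff.1 hq.1) q.2 (mem_ball_zero_iff.1 hq.2).le).trans (by norm_num))
  have h2 : ContDiffOn ℝ ∞ (fun q : ℂ × ℂ => 𝒥.Qinv₀ q.2 (Φ₀ q.1 q.2))
      (Metric.ball 0 ε ×ˢ Metric.ball 0 2) :=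
    ((𝒥.contDiff_Qinv₀_and.1.comp contDiff_snd).contDiffOn).clm_apply (hΦ₀s.mono hsub)
  exact h1.prodMk h2

/-- **Joint smoothness of the chart-`1` map of the family** on `B_ε × B_2`. [folklore] -/
theorem contDiffOn_vmap₁_family {Ξ₁ Φ₁ : ℂ → ℂ → ℂ}
    (hΞ₁s : ContDiffOn ℝ ∞ (fun q : ℂ × ℂ => Ξ₁ q.1 q.2) (Metric.ball 0 ε ×ˢ Set.univ))
    (hΦ₁s : ContDiffOn ℝ ∞ (fun q : ℂ × ℂ => Φ₁ q.1 q.2) (Metric.ball 0 ε ×ˢ Set.univ))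
    (hΞ₁b : ∀ a : ℂ, ‖a‖ < ε → ∀ w : ℂ, ‖w‖ ≤ 2 → ‖Ξ₁ a w‖ < 2⁻¹) :
    ContDiffOn ℝ ∞ (fun q : ℂ × ℂ => 𝒥.vmap₁ (Ξ₁ q.1) (Φ₁ q.1) q.2)
      (Metric.ball 0 ε ×ˢ Metric.ball 0 2) := by
  have hsub : Metric.ball (0 : ℂ) ε ×ˢ Metric.ball (0 : ℂ) 2 ⊆ Metric.ball 0 ε ×ˢ Set.univ :=
    prod_mono Subset.rfl (subset_univ _)
  have h1 : ContDiffOn ℝ ∞ (fun q : ℂ × ℂ => expChart q.2 (Ξ₁ q.1 q.2))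
      (Metric.ball 0 ε ×ˢ Metric.ball 0 2) := by
    refine contDiffOn_expChart.comp (contDiffOn_snd.prodMk (hΞ₁s.mono hsub)) ?_
    intro q hq
    show den q.2 (Ξ₁ q.1 q.2) ≠ 0
    exact den_ne_zero_of_norm_lt_two
      ((hΞ₁b q.1 (mem_ball_zero_iff.1 hq.1) q.2 (mem_ball_zero_iff.1 hq.2).le).trans (by norm_num))
  have h2 : ContDiffOn ℝ ∞ (fun q : ℂ × ℂ => 𝒥.Qinv₁ q.2 (Φ₁ q.1 q.2))
      (Metric.ball 0 ε ×ˢ Metric.ball 0 2) :=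
    ((𝒥.contDiff_Qinv₁_and.1.comp contDiff_snd).contDiffOn).clm_apply (hΦ₁s.mono hsub)
  exact h1.prodMk h2

end Models

end SphereCR

end Literature.Geometry.Symplectic

end
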